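import Summits.CriticalPhenomena.PercolationContinuityZ3.Theorems.SahiCMTP2BoxCriterion
import Literature.Probability.LatticeModels.MTP2FourFunctions
import Mathlib.Probability.Kernel.Composition.MeasureCompProd

/-!
# Fuchs–Wang's cMTP₂ (1.2) implies their density-free cMTP₂^set (5.1)

Support file of the Sahi cell (`prim-sahi`, typer seat, generation 18; `--supports stmt-CriticalPhenomena-4575`).
Theorems only (no definitions, no named facts, no sorries).

[FuchsWang2026] Def. 1.1: `X = (X_A, X_B)` is `cMTP₂(X_B|X_A)` if `X_A` has a density `f_{X_A}` with respect to the
product measure `⊗_{i∈A} P^{X_i}` and `(x_A, x_B) ↦ P(X_B ≤ x_B | X_A = x_A) f_{X_A}(x_A)` (1.2) is mtp₂ (for some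
versions).  §5 proposes the density-free (5.1) and leaves "establishing the equivalence between (5.1) and (1.2) when
`X_A` has a density" for future research.  THIS FILE PROVES THE IMPLICATION (1.2) ⟹ (5.1), for every product reference
measure of σ-finite factors on `ℝ^A` (the paper's `⊗ P^{X_i}` is one such) and any measurable lattice as second block:

* `prod_Iic_eq_lintegral_indicator` — with `μ^A = π·f` (`π = ⊗ ρᵢ`) and a disintegration kernel `K` of the second
  block, `μ(S × (−∞,z]) = ∫ 1_S(u) K(u)(−∞,z] f(u) dπ(u)`.
* **`isCMTP2Box_of_density`**, **`isCMTP2Set_of_density`** — if `g(u, z) := K(u)(−∞,z] · f(u)` is mtp₂ on `ℝ^A × Y`,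
  then the law satisfies the box form of (5.1) (Karlin–Rinott's continuous four functions theorem, tree
  `lintegral_four_functions`, with the four functions `1_{[a,b]} g(·,x)`, `1_{[a',b']} g(·,y)`,
  `1_{[a∨a',b∨b']} g(·,x∨y)`, `1_{[a∧a',b∧b']} g(·,x∧y)`), hence (5.1) itself by the box criterion
  (`isCMTP2Set_of_isCMTP2Box`; routing through boxes is what makes the outer-measure reading of non-measurable
  `C ∧ D`, `C ∨ D` come out right).

The converse ((5.1) ⟹ an mtp₂ VERSION of (1.2)) is the density-extraction half of the paper's question and is not
treated here.  No sorries, no new axioms.  References: [FuchsWang2026] Def. 1.1, §5; [KarlinRinott1980] Thm. 2.1.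
-/

noncomputable section

namespace Summit.CriticalPhenomena.PercolationContinuityZ3.Theorems.SahiCMTP2

open MeasureTheory ProbabilityTheory Set Filter Topology Function
open Literature.Probability.LatticeModels Literature.Probability.LatticeModels.Affiliation
open scoped ENNReal SetFamily ProbabilityTheory

variable {ι Y : Type*} [Fintype ι] [MeasurableSpace Y] [Lattice Y] [TopologicalSpace Y] [OpensMeasurableSpace Y]
  [ClosedIicTopology Y]

omit [Fintype ι] in
/-- **Conditional-orthant masses under a density and a disintegration kernel**: if the first marginal of `μ` is
`π·f` and `K` disintegrates `μ` over it, then `μ(S × (−∞,z]) = ∫ 1_S(u) K(u)(−∞,z] f(u) dπ(u)` for measurable `S`.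
[this work] -/
theorem prod_Iic_eq_lintegral_indicator (π : Measure (ι → ℝ)) [SFinite π] (f : (ι → ℝ) → ℝ≥0∞) (hf : Measurable f)
    (K : Kernel (ι → ℝ) Y) [IsSFiniteKernel K] (μ : Measure ((ι → ℝ) × Y)) (hfst : μ.fst = π.withDensity f)
    (hdis : μ.fst ⊗ₘ K = μ) {S : Set (ι → ℝ)} (hS : MeasurableSet S) (z : Y) :
    μ (S ×ˢ Iic z) = ∫⁻ u, S.indicator (fun u => K u (Iic z) * f u) u ∂π := by
  have hK : Measurable fun u => K u (Iic z) := K.measurable_coe measurableSet_Iic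
  haveI : SFinite μ.fst := by rw [hfst]; infer_instance
  rw [← hdis, Measure.compProd_apply_prod hS measurableSet_Iic, hfst,
    setLIntegral_withDensity_eq_setLIntegral_mul π hf hK hS, ← lintegral_indicator hS]
  congr 1
  funext u
  simp only [Set.indicator, Pi.mul_apply]
  split_ifs <;> simp [mul_comm]

/-- **[FuchsWang2026] (1.2) ⟹ the box form of (5.1).**  Let the first marginal of `μ` (law of `X_A` on `ℝ^A`) have a
measurable density `f` with respect to a product `π = ⊗ᵢ ρᵢ` of σ-finite measures, let `K` be a version of the
conditional law of the second block (`μ^A ⊗ K = μ`), and suppose `g(u,z) := K(u)(−∞,z] · f(u)` is mtp₂ on `ℝ^A × Y`: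
`g(p) g(q) ≤ g(p ∧ q) g(p ∨ q)`.  Then `μ` satisfies `IsCMTP2Box`. [this work] -/
theorem isCMTP2Box_of_density (ρ : ι → Measure ℝ) [∀ i, SigmaFinite (ρ i)] (f : (ι → ℝ) → ℝ≥0∞)
    (hf : Measurable f) (K : Kernel (ι → ℝ) Y) [IsSFiniteKernel K] (μ : Measure ((ι → ℝ) × Y))
    (hfst : μ.fst = (Measure.pi ρ).withDensity f) (hdis : μ.fst ⊗ₘ K = μ)
    (hmtp : ∀ p q : (ι → ℝ) × Y, (K p.1 (Iic p.2) * f p.1) * (K q.1 (Iic q.2) * f q.1) ≤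
      (K (p ⊓ q).1 (Iic (p ⊓ q).2) * f (p ⊓ q).1) * (K (p ⊔ q).1 (Iic (p ⊔ q).2) * f (p ⊔ q).1)) :
    IsCMTP2Box μ := by
  intro a b a' b' x y
  set g : Y → (ι → ℝ) → ℝ≥0∞ := fun z u => K u (Iic z) * f u with hg
  have hgm : ∀ z, Measurable (g z) := fun z => (K.measurable_coe measurableSet_Iic).mul hf
  have hrepr : ∀ (c d : ι → ℝ) (z : Y), μ (Icc c d ×ˢ Iic z) = ∫⁻ u, (Icc c d).indicator (g z) u ∂Measure.pi ρ :=
    fun c d z => prod_Iic_eq_lintegral_indicator (Measure.pi ρ) f hf K μ hfst hdis measurableSet_Icc z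
  rw [hrepr, hrepr, hrepr, hrepr]
  -- Karlin–Rinott with `f₁ = 1_[a,b] g_x`, `f₂ = 1_[a',b'] g_y`, `f₃ = 1_[a∨a',b∨b'] g_{x∨y}`, `f₄ = 1_[a∧a',b∧b'] g_{x∧y}`
  have key := lintegral_four_functions ρ ((Icc a b).indicator (g x)) ((Icc a' b').indicator (g y))
    ((Icc (a ⊔ a') (b ⊔ b')).indicator (g (x ⊔ y))) ((Icc (a ⊓ a') (b ⊓ b')).indicator (g (x ⊓ y)))
    ((hgm x).indicator measurableSet_Icc) ((hgm y).indicator measurableSet_Icc)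
    ((hgm _).indicator measurableSet_Icc) ((hgm _).indicator measurableSet_Icc) fun u v => ?_
  · calc (∫⁻ u, (Icc a b).indicator (g x) u ∂Measure.pi ρ) * (∫⁻ u, (Icc a' b').indicator (g y) u ∂Measure.pi ρ)
        ≤ (∫⁻ u, (Icc (a ⊔ a') (b ⊔ b')).indicator (g (x ⊔ y)) u ∂Measure.pi ρ) *
            (∫⁻ u, (Icc (a ⊓ a') (b ⊓ b')).indicator (g (x ⊓ y)) u ∂Measure.pi ρ) := key
      _ = _ := mul_comm _ _
  · by_cases hu : u ∈ Icc a b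
    · by_cases hv : v ∈ Icc a' b'
      · have huv₁ : u ⊔ v ∈ Icc (a ⊔ a') (b ⊔ b') := ⟨sup_le_sup hu.1 hv.1, sup_le_sup hu.2 hv.2⟩
        have huv₂ : u ⊓ v ∈ Icc (a ⊓ a') (b ⊓ b') := ⟨inf_le_inf hu.1 hv.1, inf_le_inf hu.2 hv.2⟩
        rw [indicator_of_mem hu, indicator_of_mem hv, indicator_of_mem huv₁, indicator_of_mem huv₂]
        exact (hmtp (u, x) (v, y)).trans_eq (mul_comm _ _)
      · rw [indicator_of_notMem hv, mul_zero]; exact bot_le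
    · rw [indicator_of_notMem hu, zero_mul]; exact bot_le

/-- **[FuchsWang2026] (1.2) ⟹ (5.1)** (`cMTP₂(X_B|X_A) ⟹ cMTP₂^set(X_B|X_A)`), for a finite law `μ` on `ℝ^A × Y`: under the
hypotheses of `isCMTP2Box_of_density`, `μ` satisfies `IsCMTP2Set` (box form + the box criterion). [this work] -/
theorem isCMTP2Set_of_density (ρ : ι → Measure ℝ) [∀ i, SigmaFinite (ρ i)] (f : (ι → ℝ) → ℝ≥0∞)
    (hf : Measurable f) (K : Kernel (ι → ℝ) Y) [IsSFiniteKernel K] (μ : Measure ((ι → ℝ) × Y)) [IsFiniteMeasure μ]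
    (hfst : μ.fst = (Measure.pi ρ).withDensity f) (hdis : μ.fst ⊗ₘ K = μ)
    (hmtp : ∀ p q : (ι → ℝ) × Y, (K p.1 (Iic p.2) * f p.1) * (K q.1 (Iic q.2) * f q.1) ≤
      (K (p ⊓ q).1 (Iic (p ⊓ q).2) * f (p ⊓ q).1) * (K (p ⊔ q).1 (Iic (p ⊔ q).2) * f (p ⊔ q).1)) :
    IsCMTP2Set μ :=
  isCMTP2Set_of_isCMTP2Box μ (isCMTP2Box_of_density ρ f hf K μ hfst hdis hmtp)

end Summit.CriticalPhenomena.PercolationContinuityZ3.Theorems.SahiCMTP2
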